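import Literature.Probability.Distributions.GaussianRejectionSampler
import Literature.Computability.Cryptography.CoinMatrixReaders
import Literature.Computability.Cryptography.CoinBlockLaws
import HarnessLib

/-!
# The Gaussian rejection sampler read off a coin string: the function, and its law on uniform coins

Topic `Computability/Cryptography` (coins and samplers), grouping namespace `GaussRejCoins`; the
realisation on coin words of the sampler of `Probability/Distributions/GaussianRejectionSampler.lean`
(GPV 2008, §4.1 "SampleZ", with exact rational arithmetic: acceptance numerators `accNum`, proposal
window `window`, law `GaussRej.rejLaw θ c s N P w R` of `R` rounds drawing a uniform
`(o, u) ∈ [0, 2^{w+1}) × [0, 2ᴾ)` each). A machine holds COINS, not uniform pairs: round `r` reads the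
`r`-th chunk of `w + 1 + P` coin bits, splits it into the proposal bits (value `o`) and the acceptance
bits (value `u`), accepts iff `u < accNum(window o)`; the first accepting round returns its window
point, `round c` if none does.

* `pairOf w P v` — the pair `(o, u)` read off a word of `w + 1 + P` bits (`bitsToNat`, least
  significant bit first; `vecSplit`, `vectorEquivFin`); **`uniformVector_map_pairOf`** — on a uniform word
  it is uniform on `[0, 2^{w+1}) × [0, 2ᴾ)`;
* `firstAccepted θ c s N P w : List (pair) → ℤ` — the decision of the rounds in order;
  **`indepLaw_map_firstAccepted`** — on `R` independent uniform pairs its law is `rejLaw … R`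
  (the recursion of `rejLaw`, `indepLaw_succ`);
* `sample θ c s N P w R coins` — the sampler read off a coin string of length `≥ (w+1+P)·R`
  (`chunks`), and **`uniformVector_map_sample`**: on uniform coins its law is `rejLaw θ c s N P w R`
  (`uniformVector_map_chunks_eq_indepLaw`, `indepLaw_map_pi`). With
  `GaussRej.tvDist_rejLaw_le_of_params` this is the end-to-end guarantee of a coin-driven discrete
  Gaussian sampler on `ℤ`.

Everything here is PROVED; the definitions have bodies; no named fact.

## References

* C. Gentry, C. Peikert, V. Vaikuntanathan, *Trapdoors for hard lattices and new cryptographic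
  constructions*, STOC 2008, §4.1 (SampleZ by rejection) [GentryPeikertVaikuntanathan2008].
* S. Arora, B. Barak, *Computational Complexity: A Modern Approach*, CUP 2009, Def. 7.1 (coins of a
  probabilistic machine) [AroraBarak2009].
-/

noncomputable section

namespace Literature.Computability.Cryptography

namespace GaussRejCoins

open PMF Literature.Probability.Distributions Literature.Probability.Distributions.GaussRej CoinReaders

variable (θ c : ℚ) (s N P w : ℕ)

/-! ### One round's data read off a word -/

/-- The width of one round's coin chunk: `w + 1` proposal bits and `P` acceptance bits. [folklore] -/
abbrev width (w P : ℕ) : ℕ := w + 1 + P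

/-- Splitting a word of `a + b` bits into its first `a` and last `b` bits (a bijection). [folklore] -/
def splitAt (a b : ℕ) : List.Vector Bool (a + b) ≃ List.Vector Bool a × List.Vector Bool b where
  toFun v := (⟨v.toList.take a, by simp⟩, ⟨v.toList.drop a, by simp⟩)
  invFun p := ⟨p.1.toList ++ p.2.toList, by simp⟩
  left_inv v := List.Vector.eq _ _ (by simp)
  right_inv p := by
    rcases p with ⟨⟨l₁, h₁⟩, ⟨l₂, h₂⟩⟩
    simp only [List.Vector.toList_mk, Prod.mk.injEq]
    constructor
    · exact List.Vector.eq _ _ (by simp [h₁])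
    · exact List.Vector.eq _ _ (by simp [h₁])

/-- **The pair `(o, u)` of a round read off its word**: the value of the first `w + 1` bits and the
value of the remaining `P` bits (`bitsToNat`, least significant bit first).
[cite: GentryPeikertVaikuntanathan2008, §4.1] -/
def pairOf (v : List.Vector Bool (width w P)) : Fin (2 ^ (w + 1)) × Fin (2 ^ P) :=
  Prod.map (vectorEquivFin (w + 1)) (vectorEquivFin P) (splitAt (w + 1) P v)

/-- **On a uniform word the pair is uniform.** [cite: AroraBarak2009, Def. 7.1] -/
theorem uniformVector_map_pairOf :
    (uniformOfFintype (List.Vector Bool (width w P))).map (pairOf P w) =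
      uniformOfFintype (Fin (2 ^ (w + 1)) × Fin (2 ^ P)) := by
  have h : pairOf P w = (Equiv.prodCongr (vectorEquivFin (w + 1)) (vectorEquivFin P)) ∘ splitAt (w + 1) P := by
    funext v; rfl
  rw [h, ← PMF.map_comp, uniformOfFintype_map_equiv (splitAt (w + 1) P), uniformOfFintype_map_equiv]

/-! ### The rounds -/

/-- **The decision of the rounds, in order**: the window point of the first accepting pair, `round c`
if none accepts. [cite: GentryPeikertVaikuntanathan2008, §4.1 ("otherwise repeat")] -/
def firstAccepted : List (Fin (2 ^ (w + 1)) × Fin (2 ^ P)) → ℤ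
  | [] => round c
  | ou :: rest => if accept θ c s N P w ou then window c w ou.1 else firstAccepted rest

/-- **On `R` independent uniform pairs the decision has the law `rejLaw R`.**
[cite: GentryPeikertVaikuntanathan2008, §4.1] -/
theorem indepLaw_map_firstAccepted : ∀ R : ℕ,
    (indepLaw R fun _ => uniformOfFintype (Fin (2 ^ (w + 1)) × Fin (2 ^ P))).map
        (fun d => firstAccepted θ c s N P w (List.ofFn d)) = rejLaw θ c s N P w R
  | 0 => by
    rw [indepLaw_zero, PMF.pure_map]
    rfl
  | R + 1 => by
    rw [indepLaw_succ, PMF.map_bind, rejLaw]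
    refine congrArg _ (funext fun ou => ?_)
    rw [PMF.map_comp]
    have hcomp : ((fun d : Fin (R + 1) → Fin (2 ^ (w + 1)) × Fin (2 ^ P) => firstAccepted θ c s N P w (List.ofFn d)) ∘
        fun v => Fin.cons ou v) =
        fun v => if accept θ c s N P w ou then window c w ou.1 else firstAccepted θ c s N P w (List.ofFn v) := by
      funext v
      simp only [Function.comp_apply, List.ofFn_succ, Fin.cons_zero, Fin.cons_succ, firstAccepted]
    rw [hcomp]
    by_cases h : accept θ c s N P w ou
    · simp only [if_pos h]
      rw [show (fun _ : Fin R → Fin (2 ^ (w + 1)) × Fin (2 ^ P) => window c w ou.1) =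
          Function.const _ (window c w ou.1) from rfl, PMF.map_const]
    · simp only [if_neg h]
      exact indepLaw_map_firstAccepted R

/-! ### The sampler read off a coin string -/

/-- **The sampler read off a coin string** of length `Ct ≥ (w+1+P)·R`: round `r` reads chunk `r`.
[cite: GentryPeikertVaikuntanathan2008, §4.1] -/
def sample (R : ℕ) {Ct : ℕ} (h : width w P * R ≤ Ct) (coins : List.Vector Bool Ct) : ℤ :=
  firstAccepted θ c s N P w (List.ofFn fun r : Fin R => pairOf P w (chunks (width w P) R h coins r))

/-- **On uniform coins the sampler has the law `rejLaw R`** — hence (with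
`GaussRej.tvDist_rejLaw_le_of_params`) it is close to the discrete Gaussian `D_{ℤ,√(π/θ),c}`.
[cite: GentryPeikertVaikuntanathan2008, §4.1 and Lemma 4.2] [cite: AroraBarak2009, Def. 7.1] -/
theorem uniformVector_map_sample (R : ℕ) {Ct : ℕ} (h : width w P * R ≤ Ct) :
    (uniformOfFintype (List.Vector Bool Ct)).map (sample θ c s N P w R h) = rejLaw θ c s N P w R := by
  have hdec : sample θ c s N P w R h =
      (fun d : Fin R → Fin (2 ^ (w + 1)) × Fin (2 ^ P) => firstAccepted θ c s N P w (List.ofFn d)) ∘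
        (fun ws : Fin R → List.Vector Bool (width w P) => fun r => pairOf P w (ws r)) ∘ chunks (width w P) R h := by
    funext coins; rfl
  rw [hdec, ← PMF.map_comp, ← PMF.map_comp, uniformVector_map_chunks_eq_indepLaw,
    indepLaw_map_pi R (fun _ => uniformOfFintype (List.Vector Bool (width w P))) (fun _ => pairOf P w)]
  simp_rw [uniformVector_map_pairOf]
  exact indepLaw_map_firstAccepted θ c s N P w R

end GaussRejCoins

end Literature.Computability.Cryptography

end
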